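import Literature.MathematicalPhysics.QuantumFieldTheory.ConformalBootstrap3D.BlockConjugationSymmetry
import Mathlib.Analysis.Normed.Group.InfiniteSum
import Mathlib.Topology.Algebra.InfiniteSum.Order
import HarnessLib

/-!
# Two-sided control of the `⟨σεσε⟩` block by the `⟨εσσε⟩` block (block-level Cauchy–Schwarz)

The `z`-series of the mixed-channel blocks at a real point `(x, y)` of the square (Dolan–Osborn 2004 §3 in
Hogervorst–Rychkov normalisation, tree `hrZTermAB a b Δ ℓ x y (n,j) = (A_{n,j}(a,b)/λ_ℓ) 𝒫_{Δ+n,j}(x,y)`):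

* `gmm = g^{s,s}_{Δ,ℓ}` (`Δ₁₂ = Δ₃₄ = s`, `a = -s/2 = -b`; for the `σ–ε` system `s = Δ_σε`, the `⟨σεσε⟩` ordering)
  has SIGN-INDEFINITE coefficients `A_{n,j}(-c, c)`, `c = s/2`;
* `gpm = g^{-s,s}_{Δ,ℓ}` (`a = b = c`, the `⟨εσσε⟩` ordering) has coefficients `A(c,c) ≥ 0`;
* `v^{s} · gpm = g^{s,-s}_{Δ,ℓ}` (`BlockConjugationSymmetry`: Dolan–Osborn 2011 eq. (2.44); the `⟨σεεσ⟩`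
  ordering, `a = b = -c`) has coefficients `A(-c,-c) ≥ 0`;

and termwise `A(-c,c)² = A(c,c)·A(-c,-c)` (Dolan–Osborn 2004 eq. (3.11), tree `hrCoeffAB_neg_sq`). Hence the
terms `T_q, P_q, Q_q` of the three series satisfy `T_q² = P_q Q_q` (`hrZTermAB_neg_sq_eq_mul`) and, for every
`θ > 0`, `|T_q| ≤ (θ P_q + Q_q/θ)/2`. Summing — over all `(n,j)` or over the complement of any finite head set
`F` — gives the certified two-sided enclosure of the sign-indefinite block by the two positive ones
(Pappadopulo–Rychkov–Espin–Rattazzi 2012 §5: "by Cauchy inequality" between a non-reflection-positive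
ordering and the two reflection-positive ones, here termwise at the level of blocks):

* `IsConformalBlock3D.hasSum_hrZTermAB_neg` — the `(n,j)`-double series of `gmm` converges ABSOLUTELY to
  `gmm(x,y)` (domination by the two positive series);
* `IsConformalBlock3D.abs_gmm_sub_sum_le` — for every finite `F ⊂ ℕ × ℕ` and `θ > 0`:
  `|gmm(x,y) - Σ_{q∈F} T_q| ≤ (θ·(gpm(x,y) - Σ_{q∈F} P_q) + (v^s gpm(x,y) - Σ_{q∈F} Q_q)/θ)/2`,
  `v = (1-x)(1-y)` — a LINEAR (LP-row-shaped) tail bound from the typed `gpm` ALONE;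
* `IsConformalBlock3D.abs_gmm_le` — `F = ∅`, `θ = v^{s/2}`: `|gmm(x,y)| ≤ ((1-x)(1-y))^{s/2} · gpm(x,y)`;
* `SigmaEpsilonData.abs_gmm_le` / `abs_gmm_sub_sum_le` — the same for the data of the `σ–ε` system under A2.

Hypotheses throughout: regular `(Δ, ℓ)` strictly above the unitarity bound, and `Δ ≠ 1` when `ℓ = 0` (where
the Dolan–Osborn factor `Π_{00}` vanishes and the geometric-mean identity is not available in factorised form).
This is recipe R10 of pub-ising3d AXIOMS-SOURCES §10 as a theorem; it supersedes the `Q̃`-ratio form of R8′ (no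
division by the coefficients of `gpm`, so the double zero on the twist-`(1-s)` line is harmless).

References: D. Pappadopulo, S. Rychkov, J. Espin, R. Rattazzi, Phys. Rev. D 86 (2012) 105043, §5
[cite: PappadopuloRychkovEspinRattazzi2012, §5]; F. A. Dolan, H. Osborn, Nucl. Phys. B 678 (2004) 491, §3
eq. (3.11) [cite: DolanOsborn2004, §3 eq. (3.11)]; F. A. Dolan, H. Osborn, arXiv:1108.6194, §2 eq. (2.44)
[cite: DolanOsborn2011, §2 eq. (2.44)].
-/

namespace Literature.MathematicalPhysics.QuantumFieldTheory.ConformalBootstrap3D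

open Finset Set

/-! ### A generic geometric-mean summation lemma -/

/-- If `t_i² = p_i q_i` with `p, q ≥ 0`, then for every `θ > 0`, `|t_i| ≤ (θ p_i + q_i/θ)/2` (AM–GM).
[folklore] -/
theorem abs_le_am_of_sq_eq_mul {t p q θ : ℝ} (hθ : 0 < θ) (hsq : t ^ 2 = p * q) (hp : 0 ≤ p)
    (hq : 0 ≤ q) : |t| ≤ (θ * p + q / θ) / 2 := by
  have hm : 0 ≤ (θ * p + q / θ) / 2 := by positivity
  refine abs_le_of_sq_le_sq ?_ hm
  have hθne : θ ≠ 0 := hθ.ne'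
  have key : ((θ * p + q / θ) / 2) ^ 2 - t ^ 2 = ((θ * p - q / θ) / 2) ^ 2 := by
    rw [hsq]
    field_simp
    ring
  nlinarith [sq_nonneg ((θ * p - q / θ) / 2), key]

/-- **Geometric-mean summation.** If `t_i² = p_i q_i`, `p, q ≥ 0`, `Σ p = A`, `Σ q = B` and `Σ t = C`, then
`t` is absolutely summable and `|C| ≤ (θ A + B/θ)/2` for every `θ > 0` (termwise AM–GM, then
`‖Σ t‖ ≤ Σ |t|`). [folklore] -/
theorem abs_le_am_of_hasSum_sq_eq_mul {ι : Type*} {t p q : ι → ℝ} {A B C θ : ℝ} (hθ : 0 < θ)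
    (hsq : ∀ i, t i ^ 2 = p i * q i) (hp : ∀ i, 0 ≤ p i) (hq : ∀ i, 0 ≤ q i)
    (hA : HasSum p A) (hB : HasSum q B) (hC : HasSum t C) : |C| ≤ (θ * A + B / θ) / 2 := by
  have hm : HasSum (fun i => (θ * p i + q i / θ) / 2) ((θ * A + B / θ) / 2) := by
    have h := (hA.mul_left θ).add (hB.div_const θ)
    convert h.div_const 2 using 1
  have hdom : ∀ i, ‖t i‖ ≤ (θ * p i + q i / θ) / 2 := fun i => by
    rw [Real.norm_eq_abs]; exact abs_le_am_of_sq_eq_mul hθ (hsq i) (hp i) (hq i)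
  have habs : Summable (fun i => ‖t i‖) :=
    Summable.of_nonneg_of_le (fun i => norm_nonneg _) hdom hm.summable
  calc |C| = ‖∑' i, t i‖ := by rw [hC.tsum_eq, Real.norm_eq_abs]
    _ ≤ ∑' i, ‖t i‖ := norm_tsum_le_tsum_norm habs
    _ ≤ (θ * A + B / θ) / 2 := hasSum_le hdom habs.hasSum hm

/-- Under the same hypotheses `t` is absolutely summable. [folklore] -/
theorem summable_abs_of_sq_eq_mul {ι : Type*} {t p q : ι → ℝ} {A B : ℝ}
    (hsq : ∀ i, t i ^ 2 = p i * q i) (hp : ∀ i, 0 ≤ p i) (hq : ∀ i, 0 ≤ q i)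
    (hA : HasSum p A) (hB : HasSum q B) : Summable (fun i => |t i|) := by
  have hm : HasSum (fun i => (1 * p i + q i / 1) / 2) ((1 * A + B / 1) / 2) := by
    have h := (hA.mul_left 1).add (hB.div_const 1)
    convert h.div_const 2 using 1
  exact Summable.of_nonneg_of_le (fun i => abs_nonneg _)
    (fun i => abs_le_am_of_sq_eq_mul one_pos (hsq i) (hp i) (hq i)) hm.summable

/-! ### The three series of the mixed channel at a real point -/

section MixedPoint

variable {s Δ : ℝ} {ℓ : ℕ} {gmm gpm : ℝ → ℝ → ℝ}

/-- **Termwise geometric mean**: `T_q² = P_q · Q_q` for the terms of `g^{s,s}` (`a = -s/2, b = s/2`),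
`g^{-s,s}` (`a = b = s/2`) and `g^{s,-s}` (`a = b = -s/2`) — Dolan–Osborn 2004 eq. (3.11) via
`hrCoeffAB_neg_sq`, valid strictly above the unitarity bound with `Δ ≠ 1` if `ℓ = 0`.
[cite: DolanOsborn2004, §3 eq. (3.11)] -/
theorem hrZTermAB_neg_sq_eq_mul (hΔ : unitarityBound3D ℓ < Δ) (h1 : ℓ = 0 → Δ ≠ 1) (s : ℝ) (x y : ℝ)
    (q : ℕ × ℕ) :
    hrZTermAB (-s / 2) (s / 2) Δ ℓ x y q ^ 2 =
      hrZTermAB (s / 2) (s / 2) Δ ℓ x y q * hrZTermAB (-s / 2) (-s / 2) Δ ℓ x y q := by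
  unfold hrZTermAB
  have hP := (doPochFactor_zero_zero_pos hΔ h1 q.1 q.2).ne'
  have key := hrCoeffAB_neg_sq (a := -s / 2) (ℓ := ℓ) (n := q.1) (j := q.2) hP
  have hb : -(-s / 2) = s / 2 := by ring
  rw [hb] at key
  rw [mul_pow, div_pow, key]
  ring

/-- **The `(n,j)`-double series of `gmm = g^{s,s}` converges absolutely to `gmm(x,y)`** at every real point of
the square (regular `(Δ,ℓ)` above the bound, `Δ ≠ 1` if `ℓ = 0`), given the typed companion `gpm = g^{-s,s}`:
domination `|T_q| ≤ (P_q + Q_q)/2` by the non-negative series of `gpm` and of `v^s gpm = g^{s,-s}`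
(`BlockConjugationSymmetry`), and identification of the sum through the level series
`IsConformalBlock3D.hasSum_hrLevelAB`. [cite: DolanOsborn2004, §3 eqs. (3.10)–(3.11)] -/
theorem IsConformalBlock3D.hasSum_hrZTermAB_neg (hΔ : unitarityBound3D ℓ < Δ)
    (hreg : ¬ accidentalDegeneracy3D Δ ℓ) (h1 : ℓ = 0 → Δ ≠ 1)
    (hmm : IsConformalBlock3D s s Δ ℓ gmm) (hpm : IsConformalBlock3D (-s) s Δ ℓ gpm)
    {x y : ℝ} (hx : x ∈ Ioo (0 : ℝ) 1) (hy : y ∈ Ioo (0 : ℝ) 1) :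
    HasSum (hrZTermAB (-s / 2) (s / 2) Δ ℓ x y) (gmm x y) ∧
      Summable (fun q => |hrZTermAB (-s / 2) (s / 2) Δ ℓ x y q|) := by
  -- the two positive companions
  have hP : HasSum (hrZTermAB (s / 2) (s / 2) Δ ℓ x y) (gpm x y) :=
    hpm.hasSum_hrZTermAB hΔ hreg (by ring) hx hy
  have hconj : IsConformalBlock3D s (-s) Δ ℓ (conjBlock s gpm) := by
    have h := hpm.conj
    have he : (s - -s) / 2 = s := by ring
    rw [neg_neg, he] at h
    exact h
  have hQ : HasSum (hrZTermAB (-s / 2) (-s / 2) Δ ℓ x y) (conjBlock s gpm x y) :=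
    hconj.hasSum_hrZTermAB hΔ hreg (by ring) hx hy
  have hsq := hrZTermAB_neg_sq_eq_mul hΔ h1 s x y
  have hPnn := fun q => hrZTermAB_self_nonneg (s / 2) hΔ hx.1.le hy.1.le q
  have hQnn := fun q => hrZTermAB_self_nonneg (-s / 2) hΔ hx.1.le hy.1.le q
  have habs : Summable (fun q => |hrZTermAB (-s / 2) (s / 2) Δ ℓ x y q|) :=
    summable_abs_of_sq_eq_mul hsq hPnn hQnn hP hQ
  refine ⟨?_, habs⟩
  -- the absolutely convergent double series has SOME sum `S`; its level sums are `hrLevelAB`, which sum to `gmm`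
  have hT : HasSum (hrZTermAB (-s / 2) (s / 2) Δ ℓ x y) (∑' q, hrZTermAB (-s / 2) (s / 2) Δ ℓ x y q) :=
    (habs.of_norm_bounded (fun q => by rw [Real.norm_eq_abs])).hasSum
  have hfib : ∀ n : ℕ, HasSum (fun j : ℕ => hrZTermAB (-s / 2) (s / 2) Δ ℓ x y (n, j))
      (hrLevelAB (-s / 2) (s / 2) Δ ℓ x y n) := by
    intro n
    unfold hrLevelAB
    refine hasSum_sum_of_ne_finset_zero fun j hj => ?_
    rw [Finset.mem_range, not_lt] at hj
    unfold hrZTermAB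
    simp only
    rw [hrCoeffAB_eq_zero_of_lt _ _ Δ (show ℓ + n < j by omega), zero_div, zero_mul]
  have hlev : HasSum (hrLevelAB (-s / 2) (s / 2) Δ ℓ x y)
      (∑' q, hrZTermAB (-s / 2) (s / 2) Δ ℓ x y q) := hT.prod_fiberwise hfib
  have hlev' : HasSum (hrLevelAB (-s / 2) (s / 2) Δ ℓ x y) (gmm x y) := hmm.hasSum_hrLevelAB hΔ hreg hx hy
  rwa [hlev.unique hlev'] at hT

/-- **Two-sided tail control of `gmm` by `gpm` alone** (block-level Cauchy–Schwarz, LP-row form): at a real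
point of the square, for every finite head set `F` and every `θ > 0`,
`|gmm(x,y) - Σ_{q∈F} T_q| ≤ (θ·(gpm(x,y) - Σ_{q∈F} P_q) + (((1-x)(1-y))^s gpm(x,y) - Σ_{q∈F} Q_q)/θ)/2`,
where `T, P, Q` are the `hrZTermAB` terms with parameters `(-s/2, s/2)`, `(s/2, s/2)`, `(-s/2, -s/2)`.
Both bracketed tails are tails of NON-NEGATIVE series of typed blocks (`gpm` and `v^s gpm`).
[cite: PappadopuloRychkovEspinRattazzi2012, §5] -/
theorem IsConformalBlock3D.abs_gmm_sub_sum_le (hΔ : unitarityBound3D ℓ < Δ)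
    (hreg : ¬ accidentalDegeneracy3D Δ ℓ) (h1 : ℓ = 0 → Δ ≠ 1)
    (hmm : IsConformalBlock3D s s Δ ℓ gmm) (hpm : IsConformalBlock3D (-s) s Δ ℓ gpm)
    {x y : ℝ} (hx : x ∈ Ioo (0 : ℝ) 1) (hy : y ∈ Ioo (0 : ℝ) 1) (F : Finset (ℕ × ℕ)) {θ : ℝ}
    (hθ : 0 < θ) :
    |gmm x y - ∑ q ∈ F, hrZTermAB (-s / 2) (s / 2) Δ ℓ x y q| ≤
      (θ * (gpm x y - ∑ q ∈ F, hrZTermAB (s / 2) (s / 2) Δ ℓ x y q) +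
        (((1 - x) * (1 - y)) ^ s * gpm x y - ∑ q ∈ F, hrZTermAB (-s / 2) (-s / 2) Δ ℓ x y q) / θ) / 2 := by
  have hP : HasSum (hrZTermAB (s / 2) (s / 2) Δ ℓ x y) (gpm x y) :=
    hpm.hasSum_hrZTermAB hΔ hreg (by ring) hx hy
  have hconj : IsConformalBlock3D s (-s) Δ ℓ (conjBlock s gpm) := by
    have h := hpm.conj
    have he : (s - -s) / 2 = s := by ring
    rw [neg_neg, he] at h
    exact h
  have hQ : HasSum (hrZTermAB (-s / 2) (-s / 2) Δ ℓ x y) (((1 - x) * (1 - y)) ^ s * gpm x y) :=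
    hconj.hasSum_hrZTermAB hΔ hreg (by ring) hx hy
  have hT := (hmm.hasSum_hrZTermAB_neg hΔ hreg h1 hpm hx hy).1
  -- pass to the complement of `F`
  have hP' := (Finset.hasSum_iff_compl F).mp hP
  have hQ' := (Finset.hasSum_iff_compl F).mp hQ
  have hT' := (Finset.hasSum_iff_compl F).mp hT
  have hsq' : ∀ q : {q // q ∉ F}, hrZTermAB (-s / 2) (s / 2) Δ ℓ x y q ^ 2 =
      hrZTermAB (s / 2) (s / 2) Δ ℓ x y q * hrZTermAB (-s / 2) (-s / 2) Δ ℓ x y q :=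
    fun q => hrZTermAB_neg_sq_eq_mul hΔ h1 s x y q
  have hp' : ∀ q : {q // q ∉ F}, 0 ≤ hrZTermAB (s / 2) (s / 2) Δ ℓ x y q :=
    fun q => hrZTermAB_self_nonneg (s / 2) hΔ hx.1.le hy.1.le q
  have hq' : ∀ q : {q // q ∉ F}, 0 ≤ hrZTermAB (-s / 2) (-s / 2) Δ ℓ x y q :=
    fun q => hrZTermAB_self_nonneg (-s / 2) hΔ hx.1.le hy.1.le q
  exact abs_le_am_of_hasSum_sq_eq_mul (t := fun q : {q // q ∉ F} => hrZTermAB (-s / 2) (s / 2) Δ ℓ x y q)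
    (p := fun q : {q // q ∉ F} => hrZTermAB (s / 2) (s / 2) Δ ℓ x y q)
    (q := fun q : {q // q ∉ F} => hrZTermAB (-s / 2) (-s / 2) Δ ℓ x y q) hθ hsq' hp' hq' hP' hQ' hT'

/-- **`|g^{s,s}(x,y)| ≤ ((1-x)(1-y))^{s/2} · g^{-s,s}(x,y)`** at every real point of the square (regular
`(Δ,ℓ)` above the bound, `Δ ≠ 1` if `ℓ = 0`): the optimal `θ = v^{s/2}` in `abs_gmm_sub_sum_le` with `F = ∅`.
For the `σ–ε` system (`s = Δ_σε < 0`) the factor `v^{Δ_σε/2}` exceeds `1`. [cite: PappadopuloRychkovEspinRattazzi2012, §5] -/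
theorem IsConformalBlock3D.abs_gmm_le (hΔ : unitarityBound3D ℓ < Δ) (hreg : ¬ accidentalDegeneracy3D Δ ℓ)
    (h1 : ℓ = 0 → Δ ≠ 1) (hmm : IsConformalBlock3D s s Δ ℓ gmm) (hpm : IsConformalBlock3D (-s) s Δ ℓ gpm)
    {x y : ℝ} (hx : x ∈ Ioo (0 : ℝ) 1) (hy : y ∈ Ioo (0 : ℝ) 1) :
    |gmm x y| ≤ ((1 - x) * (1 - y)) ^ (s / 2) * gpm x y := by
  have hv : 0 < (1 - x) * (1 - y) := mul_pos (by linarith [hx.2]) (by linarith [hy.2])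
  set θ := ((1 - x) * (1 - y)) ^ (s / 2) with hθdef
  have hθ : 0 < θ := Real.rpow_pos_of_pos hv _
  have h := hmm.abs_gmm_sub_sum_le hΔ hreg h1 hpm hx hy ∅ hθ
  simp only [Finset.sum_empty, sub_zero] at h
  have hvs : ((1 - x) * (1 - y)) ^ s = θ * θ := by
    rw [hθdef, ← Real.rpow_add hv]; ring_nf
  rw [hvs] at h
  have hsimp : (θ * gpm x y + θ * θ * gpm x y / θ) / 2 = θ * gpm x y := by
    field_simp
    ring
  rwa [hsimp] at h

end MixedPoint

/-! ### The `σ–ε` system -/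

namespace SigmaEpsilonData

/-- For the data of the `σ–ε` system under A2: at every regular `(Δ_m j, ℓ_m j)` above the bound (and
`Δ ≠ 1` if `ℓ = 0`) and every real point of the square,
`|gmm_j(x,y)| ≤ ((1-x)(1-y))^{Δ_σε/2} · gpm_j(x,y)`. [cite: PappadopuloRychkovEspinRattazzi2012, §5] -/
theorem abs_gmm_le (D : SigmaEpsilonData) (hA2 : D.HasGenuineBlocks) (j : D.ιm)
    (hΔ : unitarityBound3D (D.ℓm j) < D.Δm j) (hreg : ¬ accidentalDegeneracy3D (D.Δm j) (D.ℓm j))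
    (h1 : D.ℓm j = 0 → D.Δm j ≠ 1) {x y : ℝ} (hx : x ∈ Ioo (0 : ℝ) 1) (hy : y ∈ Ioo (0 : ℝ) 1) :
    |D.gmm j x y| ≤ ((1 - x) * (1 - y)) ^ (D.Δσε / 2) * D.gpm j x y :=
  (hA2.2.1 j).abs_gmm_le hΔ hreg h1 (hA2.2.2 j) hx hy

/-- The LP-row form for the `σ–ε` data: for every finite head set `F` and `θ > 0`,
`|gmm_j(x,y) - Σ_F T| ≤ (θ (gpm_j(x,y) - Σ_F P) + (v^{Δ_σε} gpm_j(x,y) - Σ_F Q)/θ)/2`.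
[cite: PappadopuloRychkovEspinRattazzi2012, §5] -/
theorem abs_gmm_sub_sum_le (D : SigmaEpsilonData) (hA2 : D.HasGenuineBlocks) (j : D.ιm)
    (hΔ : unitarityBound3D (D.ℓm j) < D.Δm j) (hreg : ¬ accidentalDegeneracy3D (D.Δm j) (D.ℓm j))
    (h1 : D.ℓm j = 0 → D.Δm j ≠ 1) {x y : ℝ} (hx : x ∈ Ioo (0 : ℝ) 1) (hy : y ∈ Ioo (0 : ℝ) 1)
    (F : Finset (ℕ × ℕ)) {θ : ℝ} (hθ : 0 < θ) :
    |D.gmm j x y - ∑ q ∈ F, hrZTermAB (-D.Δσε / 2) (D.Δσε / 2) (D.Δm j) (D.ℓm j) x y q| ≤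
      (θ * (D.gpm j x y - ∑ q ∈ F, hrZTermAB (D.Δσε / 2) (D.Δσε / 2) (D.Δm j) (D.ℓm j) x y q) +
        (((1 - x) * (1 - y)) ^ D.Δσε * D.gpm j x y -
          ∑ q ∈ F, hrZTermAB (-D.Δσε / 2) (-D.Δσε / 2) (D.Δm j) (D.ℓm j) x y q) / θ) / 2 :=
  (hA2.2.1 j).abs_gmm_sub_sum_le hΔ hreg h1 (hA2.2.2 j) hx hy F hθ

/-- The `(n,j')`-double `z`-series of `gmm_j` converges absolutely to `gmm_j(x,y)`.
[cite: DolanOsborn2004, §3 eqs. (3.10)–(3.11)] -/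
theorem hasSum_hrZTermAB_gmm (D : SigmaEpsilonData) (hA2 : D.HasGenuineBlocks) (j : D.ιm)
    (hΔ : unitarityBound3D (D.ℓm j) < D.Δm j) (hreg : ¬ accidentalDegeneracy3D (D.Δm j) (D.ℓm j))
    (h1 : D.ℓm j = 0 → D.Δm j ≠ 1) {x y : ℝ} (hx : x ∈ Ioo (0 : ℝ) 1) (hy : y ∈ Ioo (0 : ℝ) 1) :
    HasSum (hrZTermAB (-D.Δσε / 2) (D.Δσε / 2) (D.Δm j) (D.ℓm j) x y) (D.gmm j x y) :=
  ((hA2.2.1 j).hasSum_hrZTermAB_neg hΔ hreg h1 (hA2.2.2 j) hx hy).1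

end SigmaEpsilonData

end Literature.MathematicalPhysics.QuantumFieldTheory.ConformalBootstrap3D
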